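import Mathlib
import Summits.Parity.BatemanHorn.Theses.IsogenyRedei

/-!
# Crux-plan `divisor-triangle-web` for crux stmt-Parity-11585 (`IsogenyRedei.QuadraticOmegaParity`) —
# NO-SKELETON evidence file (kernel-checked; 0 sorry)

Unit `cruxplan-stmt-Parity-11585-divisor-triangle-web` (planner, crux-plan mode, 2026-08-16).

This file is NOT a skeleton line (it registers no `stub_*` and no `QuadraticOmegaParity_of`): the idea
cannot be made into a concluding skeleton without a costume stub, and this file holds the kernel-checked
half of the reason (§2) together with the idea's genuine, re-checked lever (§1) and the corrected typed
RUNG statements that all three triagers asked to be filed SEPARATELY from the crux (§3).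

## §1 The lever (re-proved, general monic quadratic)
`eval_triangle` : for `f` monic of degree 2 and `f(u) = c·k`:  `f(u) · f(u+c) = c² · f(u+k)`.

## §2 The Liouville-twin obstruction (why no web-only composition reaches the crux)
`lam_checks` : for `f` monic of degree 2 with positive values and every triangle `{u, u+c, u+f(u)/c}`
(`c ∣ f(u)`), `λ_f(u)·λ_f(u+c)·λ_f(u+f(u)/c) = +1` where `λ_f = (−1)^{Ω(f(·))}` — because `Ω` is completely
additive and `f(u)f(u+c) = c²f(w)`.  Hence (`twin_checks`) the TWIN `ε̃ := ε·λ_f`, `ε = (−1)^{ω(f(·))}`,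
satisfies EVERY parity check of the ω-web that `ε` satisfies — same triangles, same sign types, all scales,
all divisors.  But `ε̃ = (−1)^{#{p : v_p(f(n)) even ≥ 2}}` equals `+1` on every squarefree value of `f`
(`twin_eq_one_of_squarefree`), and squarefree values of an irreducible quadratic have positive density
`c_f = ∏_p (1 − ρ_f(p²)/p²)` (Estermann 1931 for `n²+1`: `c = 0.8948…`; Ricci 1933 in general), so `ε̃` has
mean `≥ 2c_f − 1` (`= +0.8222` measured for `n²+1`, `x ≤ 10⁶`, folder `kit/twin_check.py`: 0 check failures for
`ε` and for `ε̃` on all 127 746 in-range prime-pair triangles; AP means of `ε̃` mod 3,4,5,8 all in [+0.63, +0.95]).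
Consequently any argument whose inputs are the web's checks plus `ε`-independent data (type supplies, degree /
multiplicity second moments, Turán–Kubilius, root-class counts — i.e. everything on the idea card and in the
three triage sharpenings) proves only statements that also hold for `ε̃`; `Σ_{n≤x} ε̃(n) ∼ 0.82·x` is not `o(x)`,
so no such argument proves `QuadraticOmegaParity` (nor even "both signs have density ≥ 0.09").  The web's
ceiling is the RUNG (both signs `≫ x/log x`), exactly as triage r2-1/r2-2/r2-3 found from the single-scale side;
this twin closes the multi-scale escape as well (it is a solution at ALL scales).

## §3 The rung, typed with the triage fix (`u + p ≤ x` AND `w ≤ x`), for separate filing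
`InRangeTypeSupply`, `InRangeDegreeSecondMoment`, `OmegaParityBothSignsOften` (see docstrings).
-/

namespace Summit.Parity.BatemanHorn.Cruxes.QuadraticOmegaParity.DivisorTriangleWeb

open scoped BigOperators
open Filter Finset Polynomial
open ArithmeticFunction (cardDistinctFactors cardFactors)

/-! ## §1 The divisor-triangle identity -/

/-- The divisor-triangle identity in coordinates: `u² + bu + d = ck` implies
`f(u)·f(u+c) = c²·f(u+k)` for `f = X² + bX + d`. -/
theorem triangle_identity_monic (b d u c k : ℤ) (h : u ^ 2 + b * u + d = c * k) :
    (u ^ 2 + b * u + d) * ((u + c) ^ 2 + b * (u + c) + d)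
      = c ^ 2 * ((u + k) ^ 2 + b * (u + k) + d) := by
  linear_combination (c * k + 2 * c * u + b * c + u ^ 2 + b * u + d) * h

/-- A monic polynomial of `natDegree 2` evaluates as `c₀ + c₁ z + z²`. -/
theorem eval_eq_of_monic_two {f : ℤ[X]} (hm : f.Monic) (hd : f.natDegree = 2) (z : ℤ) :
    f.eval z = f.coeff 0 + f.coeff 1 * z + z ^ 2 := by
  have h2 : f.coeff 2 = 1 := by
    have := hm.coeff_natDegree
    rwa [hd] at this
  rw [eval_eq_sum_range, hd]
  simp only [Finset.sum_range_succ, Finset.sum_range_zero, zero_add, pow_zero, mul_one, pow_one,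
    h2, one_mul]

/-- **The lever, polynomial form.** For `f` monic of degree 2 and `f(u) = c·k`:
`f(u)·f(u+c) = c²·f(u+k)`. -/
theorem eval_triangle {f : ℤ[X]} (hm : f.Monic) (hd : f.natDegree = 2) (u c k : ℤ)
    (h : f.eval u = c * k) : f.eval u * f.eval (u + c) = c ^ 2 * f.eval (u + k) := by
  rw [eval_eq_of_monic_two hm hd u] at h
  rw [eval_eq_of_monic_two hm hd u, eval_eq_of_monic_two hm hd (u + c),
    eval_eq_of_monic_two hm hd (u + k)]
  linear_combination (c * k + 2 * c * u + f.coeff 1 * c + u ^ 2 + f.coeff 1 * u + f.coeff 0) * h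

/-! ## §2 The Liouville twin passes every check of the ω-web -/

/-- `ε_f(n) = (−1)^{ω(f(n))}` in the crux's own encoding (`toNat`, `cardDistinctFactors`). -/
noncomputable def eps (f : ℤ[X]) (n : ℕ) : ℤ :=
  (-1) ^ cardDistinctFactors ((f.eval (n : ℤ)).toNat)

/-- `λ_f(n) = (−1)^{Ω(f(n))}` (Liouville of the value). -/
noncomputable def lam (f : ℤ[X]) (n : ℕ) : ℤ :=
  (-1) ^ cardFactors ((f.eval (n : ℤ)).toNat)

/-- The TWIN `ε̃_f = ε_f · λ_f = (−1)^{ω(f(n)) + Ω(f(n))} = (−1)^{#{p : v_p(f(n)) even ≥ 2}}`. -/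
noncomputable def twin (f : ℤ[X]) (n : ℕ) : ℤ := eps f n * lam f n

/-- Complete additivity of `Ω` turns `A·B = c²·W` into an even check:
`(−1)^{Ω A}(−1)^{Ω B}(−1)^{Ω W} = 1`. -/
theorem neg_one_pow_cardFactors_check {A B c W : ℕ} (hA : A ≠ 0) (hB : B ≠ 0) (hc : c ≠ 0)
    (hW : W ≠ 0) (h : A * B = c ^ 2 * W) :
    (-1 : ℤ) ^ cardFactors A * (-1) ^ cardFactors B * (-1) ^ cardFactors W = 1 := by
  have hsum : cardFactors A + cardFactors B = 2 * cardFactors c + cardFactors W := by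
    have h1 := congrArg cardFactors h
    rwa [ArithmeticFunction.cardFactors_mul hA hB,
      ArithmeticFunction.cardFactors_mul (pow_ne_zero 2 hc) hW,
      ArithmeticFunction.cardFactors_pow] at h1
  rw [← pow_add, ← pow_add, hsum,
    show 2 * cardFactors c + cardFactors W + cardFactors W = 2 * (cardFactors c + cardFactors W) by ring,
    pow_mul]
  norm_num

/-- The values of a monic quadratic with positive values satisfy the triangle identity in `ℕ`
(with the crux's `toNat` encoding and `k = f(u)/c`). -/
theorem toNat_triangle {f : ℤ[X]} (hm : f.Monic) (hd : f.natDegree = 2)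
    (hpos : ∀ n : ℕ, 0 < f.eval (n : ℤ)) (u c : ℕ) (hc : 0 < c)
    (hdvd : c ∣ (f.eval (u : ℤ)).toNat) :
    (f.eval (u : ℤ)).toNat * (f.eval ((u + c : ℕ) : ℤ)).toNat
      = c ^ 2 * (f.eval ((u + (f.eval (u : ℤ)).toNat / c : ℕ) : ℤ)).toNat := by
  obtain ⟨k, hk⟩ := hdvd
  have hkdiv : (f.eval (u : ℤ)).toNat / c = k := by rw [hk, Nat.mul_div_cancel_left k hc]
  rw [hkdiv]
  have hu : f.eval (u : ℤ) = (c : ℤ) * (k : ℤ) := by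
    rw [← Int.toNat_of_nonneg (hpos u).le, hk, Nat.cast_mul]
  have hid := eval_triangle hm hd (u : ℤ) (c : ℤ) (k : ℤ) hu
  have key : (((f.eval (u : ℤ)).toNat : ℕ) : ℤ) * (((f.eval ((u + c : ℕ) : ℤ)).toNat : ℕ) : ℤ)
      = (c : ℤ) ^ 2 * (((f.eval ((u + k : ℕ) : ℤ)).toNat : ℕ) : ℤ) := by
    rw [Int.toNat_of_nonneg (hpos u).le, Int.toNat_of_nonneg (hpos (u + c)).le,
      Int.toNat_of_nonneg (hpos (u + k)).le]
    simpa only [Nat.cast_add] using hid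
  exact_mod_cast key

/-- **`λ_f` solves the homogeneous web**: on every triangle `{u, u+c, u+f(u)/c}` the product of the three
Liouville signs is `+1` (monic `f` of degree 2 with positive values; `c ∣ f(u)`, `c > 0`). -/
theorem lam_checks {f : ℤ[X]} (hm : f.Monic) (hd : f.natDegree = 2)
    (hpos : ∀ n : ℕ, 0 < f.eval (n : ℤ)) (u c : ℕ) (hc : 0 < c)
    (hdvd : c ∣ (f.eval (u : ℤ)).toNat) :
    lam f u * lam f (u + c) * lam f (u + (f.eval (u : ℤ)).toNat / c) = 1 := by
  have hne : ∀ n : ℕ, (f.eval (n : ℤ)).toNat ≠ 0 := fun n h0 => by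
    have h1 := hpos n
    rw [Int.toNat_eq_zero] at h0
    exact absurd h0 (not_le.mpr h1)
  exact neg_one_pow_cardFactors_check (hne u) (hne (u + c)) hc.ne' (hne _)
    (toNat_triangle hm hd hpos u c hc hdvd)

/-- **The twin passes every check `ε` passes** (same triangles, same sign types — whatever they are):
`ε̃(u)ε̃(u+c)ε̃(w) = ε(u)ε(u+c)ε(w)` for `w = u + f(u)/c`.  So the ω-web's parity-check system — at one
scale or at all scales, prime pairs or all divisors — cannot distinguish `ε = (−1)^{ω∘f}` from `ε̃`. -/
theorem twin_checks {f : ℤ[X]} (hm : f.Monic) (hd : f.natDegree = 2)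
    (hpos : ∀ n : ℕ, 0 < f.eval (n : ℤ)) (u c : ℕ) (hc : 0 < c)
    (hdvd : c ∣ (f.eval (u : ℤ)).toNat) :
    twin f u * twin f (u + c) * twin f (u + (f.eval (u : ℤ)).toNat / c)
      = eps f u * eps f (u + c) * eps f (u + (f.eval (u : ℤ)).toNat / c) := by
  have h := lam_checks hm hd hpos u c hc hdvd
  simp only [twin]
  linear_combination (eps f u * eps f (u + c) * eps f (u + (f.eval (u : ℤ)).toNat / c)) * h

/-- **The twin is `+1` on every squarefree value** (`ω = Ω` there), hence — squarefree values of an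
irreducible quadratic having density `c_f = ∏_p (1 − ρ_f(p²)/p²) > 0` (Estermann 1931, Ricci 1933) — the
twin has mean `≥ 2c_f − 1` (`+0.8222` for `n²+1`, measured to `10⁶`): a maximally web-consistent, heavily
biased sign pattern. -/
theorem twin_eq_one_of_squarefree (f : ℤ[X]) (n : ℕ) (h : Squarefree ((f.eval (n : ℤ)).toNat)) :
    twin f n = 1 := by
  have h0 : ((f.eval (n : ℤ)).toNat) ≠ 0 := h.ne_zero
  have heq := (ArithmeticFunction.cardDistinctFactors_eq_cardFactors_iff_squarefree h0).mpr h
  simp only [twin, eps, lam]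
  rw [← pow_add, heq, ← two_mul, pow_mul]
  norm_num

/-! ## §3 The RUNG, typed with the triage fix — statements for SEPARATE filing (not stubs of a line)

Triage r2-1 / r2-2 (s1) / r2-3 (B): the ideator's `primePairs` / `farMult` let `p` range to `x²+1` with only the
far-point condition; the forcing argument needs the whole triangle inside `[1, x]`, i.e. `u + p ≤ x` AND
`w = u + f(u)/p ≤ x`.  With that fix the measured supplies are `1.70 / 0.24 · x/log x` (even / odd type,
`n²+1`, `x = 2·10⁶`, kit j013505) resp. `1.51 / 0.21` with `u + p ≤ x` (j013605, `x = 4·10⁶`), the degree and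
multiplicity second moments are `≍ x/log x`, and Cauchy–Schwarz forcing gives both ω-parities `≫ x/log x`.
-/

/-- Sign type of the triangle based at `u` with divisor `c` of `f(u)` (codivisor `k = f(u)/c`):
`s = (−1)^{ω(gcd(f u, f(u+c))) + ω(c) + ω(gcd(c, f(u+k)))}`; `ε(u)ε(u+c)ε(u+k) = s` is the parity-check law
(provable now from `eval_triangle` and `ω(ab) = ω(a) + ω(b) − ω(gcd(a,b))`). -/
noncomputable def triType (f : ℤ[X]) (u c : ℕ) : ℤ :=
  let fu := (f.eval (u : ℤ)).toNat
  let k := fu / c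
  (-1) ^ (cardDistinctFactors (Nat.gcd fu ((f.eval ((u + c : ℕ) : ℤ)).toNat))
        + cardDistinctFactors c
        + cardDistinctFactors (Nat.gcd c ((f.eval ((u + k : ℕ) : ℤ)).toNat)))

/-- PARITY-CHECK LAW of the ω-web (theorem-grade, provable now; honours Disproof
`quadraticOmegaParity_false_without_posLead` by assuming positive values). -/
def ParityCheckLaw : Prop :=
  ∀ f : ℤ[X], f.Monic → f.natDegree = 2 → (∀ n : ℕ, 0 < f.eval (n : ℤ)) →
    ∀ u c : ℕ, 0 < c → c ∣ (f.eval (u : ℤ)).toNat →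
      eps f u * eps f (u + c) * eps f (u + (f.eval (u : ℤ)).toNat / c) = triType f u c

/-- IN-RANGE prime pairs of sign type `s`: `u ≤ x`, `p` prime, `p ∣ f(u)`, middle point `u + p ≤ x` AND far
point `u + f(u)/p ≤ x` (the triage fix), `triType f u p = s`. -/
noncomputable def inRangePrimePairs (f : ℤ[X]) (x : ℕ) (s : ℤ) : Finset (ℕ × ℕ) :=
  ((Icc 1 x) ×ˢ (Icc 1 x)).filter (fun q : ℕ × ℕ =>
    q.2.Prime ∧ q.2 ∣ (f.eval (q.1 : ℤ)).toNat ∧ q.1 + q.2 ≤ x ∧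
      q.1 + (f.eval (q.1 : ℤ)).toNat / q.2 ≤ x ∧ triType f q.1 q.2 = s)

/-- In-range degree of a point `v ≤ x`: the number of in-range prime-pair triangles (either type) having `v`
as a vertex (base, middle or far point). -/
noncomputable def inRangeDegree (f : ℤ[X]) (x v : ℕ) : ℕ :=
  (((Icc 1 x) ×ˢ (Icc 1 x)).filter (fun q : ℕ × ℕ =>
    q.2.Prime ∧ q.2 ∣ (f.eval (q.1 : ℤ)).toNat ∧ q.1 + q.2 ≤ x ∧
      q.1 + (f.eval (q.1 : ℤ)).toNat / q.2 ≤ x ∧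
      (q.1 = v ∨ q.1 + q.2 = v ∨ q.1 + (f.eval (q.1 : ℤ)).toNat / q.2 = v))).card

/-- SUPPLY (tier A₂ of triage r2-2 (s2): full strength needs Duke–Friedlander–Iwaniec / Tóth root
equidistribution to prime moduli with congruence refinements; the sub-web `p ≤ x^{1−η}` is elementary and
gives `x^{1−η/2}/log x`): both sign types have in-range supply `≫_f x/log x`. -/
def InRangeTypeSupply : Prop :=
  ∀ f : ℤ[X], f.Monic → Irreducible f → f.natDegree = 2 → (∀ n : ℕ, 0 < f.eval (n : ℤ)) →
    ∀ s : ℤ, (s = 1 ∨ s = -1) → ∃ c : ℝ, 0 < c ∧ ∀ᶠ x : ℕ in atTop,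
      c * (x : ℝ) / Real.log x ≤ ((inRangePrimePairs f x s).card : ℝ)

/-- DEGREE SECOND MOMENT (upper-bound sieve with SL₂(ℤ)/Gaussian lattice-point remainders, triage r2-3 (B);
Nair–Tenenbaum `Σ τ(f(v))² ≪ x log³x` gives it up to `log⁴`): `Σ_{v≤x} deg(v)² ≪_f x/log x`. -/
def InRangeDegreeSecondMoment : Prop :=
  ∀ f : ℤ[X], f.Monic → Irreducible f → f.natDegree = 2 → (∀ n : ℕ, 0 < f.eval (n : ℤ)) →
    ∃ C : ℝ, 0 < C ∧ ∀ᶠ x : ℕ in atTop,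
      (∑ v ∈ Icc 1 x, ((inRangeDegree f x v : ℝ) ^ 2)) ≤ C * (x : ℝ) / Real.log x

/-- **THE RUNG** (theorem-candidate, two powers of log below the crux; print has "infinitely often" /
`≫ log x` for `λ(f(n))` via Pell, Borwein–Choi–Ganguli 2013, Srinivasan 2022, Teräväinen 2024 §3.4, and nothing
for ω-parity of `n²+1`): for every monic irreducible quadratic `f` and each parity `v`,
`#{n ≤ x : ω(f(n)) ≡ v (mod 2)} ≫_f x / log x`.  Forcing proof: ParityCheckLaw + InRangeTypeSupply +
InRangeDegreeSecondMoment + Cauchy–Schwarz (`#{ε = σ} ≥ T_{type}² / Σ deg²`).  (Finitely many non-positive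
values of `f` are harmless for a lower bound, so no positivity hypothesis is needed in the statement.) -/
def OmegaParityBothSignsOften : Prop :=
  ∀ f : ℤ[X], f.Monic → Irreducible f → f.natDegree = 2 → ∀ v : ℕ, v < 2 →
    ∃ c : ℝ, 0 < c ∧ ∀ᶠ x : ℕ in atTop,
      c * (x : ℝ) / Real.log x ≤
        (((Icc 1 x).filter (fun n : ℕ =>
          cardDistinctFactors ((f.eval (n : ℤ)).toNat) % 2 = v)).card : ℝ)

/-- The crux by name (the horizon this line does NOT reach). -/
example : Prop := Summit.Parity.BatemanHorn.Theses.IsogenyRedei.QuadraticOmegaParity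

end Summit.Parity.BatemanHorn.Cruxes.QuadraticOmegaParity.DivisorTriangleWeb
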